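import Summits.CriticalPhenomena.PercolationContinuityZ3.Theorems.Transplant.FKConnectivityAllQFastEvalBridge
import Summits.CriticalPhenomena.PercolationContinuityZ3.Theorems.Transplant.FKConnectivityAllQTwoClusterRayleighNoSq
import HarnessLib

/-!
# ADJACENCY IS ESSENTIAL: the all-pairs coefficientwise forest Rayleigh property (Semple–Welsh's "strong independence correlation",
# graphic case) FAILS on `K₄` at a disjoint pair — kernel certificate (`¬ ForestRayleighNoSqOn (Fin 4)`); the adjacent node is its restriction

Support file (`--supports stmt-CriticalPhenomena-4575`), FK sub-lane `prim-bschramm-fk-1` (gen 17) of the post-continuity programme;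
builds on p205010 (kernel theorem, internal audit signed; external expert review pending).  One definition (a counting predicate, NOT
asserted) and one listed graph, no named facts, no sorries; standard axioms (`decide +kernel` on `2⁶` configurations, instant).

`AdjForestRayleighNoSqOn V` (p310496; implied by R_q⁰, gen 17's `adjForestRayleighNoSqPos_of_gradedNoSqPos`) asks coefficientwise
Rayleigh `[x^M](F_e F_f − F_{ef} F) ≤ 0`-type monotonicity of spanning forests only for ADJACENT pairs `e = ov`, `f = oy`.  This file
types the ALL-PAIRS version **`ForestRayleighNoSqOn V`** (same fibre inequality for every two pairs `e ≠ f`) — for graphic matroids this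
is Semple–Welsh's "strongly independence correlated" (coefficientwise negative correlation of the forest generating polynomial) — records
`adjForestRayleighNoSqOn_of_forestRayleighNoSqOn` (all pairs ⇒ adjacent pairs), and REFUTES it in the kernel on `K₄` at the disjoint
pair `e = 01`, `f = 23`, fibre = all six edges, `u₀ = ∅`: `bad = #(Fo ∋ e,f ; Fo) = 4 > 2 = #(Fo ∋ e ; Fo ∋ f) = good`
(**`not_forestRayleighNoSqOn_fin_four`**), reproducing the easy half of Semple–Welsh 2008 Thm 4.2 ("`M(K₄)` is not strongly
independence correlated"; their Conj. 1.1 / the Kahn–Grimmett–Winkler conjecture concern the PROBABILITY-level inequality, which holds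
on `K₄`).  So the adjacency hypothesis of the live node cannot be dropped, already at 4 vertices; by gen 16/17's censuses the adjacent
form has no failure through 8 vertices (1.2·10¹⁰ placements).  Certificate by gen 17's fast evaluator (`…FastEval*.lean`): indicators
`gbad / ggood`, `fibreCount_conf_eq_card_bool`, `three_counts_eq_sumR`, one `decide +kernel`.
[cite: SempleWelsh2008, Thm. 4.2 (p. 11); Conj. 1.1 (p. 2)] [cite: Linusson2011, Prop. 2.6]
[cite: Grimmett2006, §1.5 eq. (1.22) (p. 13)]
-/

namespace Summit.CriticalPhenomena.PercolationContinuityZ3.Theorems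

namespace FK

open MeasureTheory Set Literature.Probability.LatticeModels Literature.Probability.Percolation
open scoped Classical symmDiff

/-! ### The all-pairs node (NOT asserted) -/

/-- **All-pairs coefficientwise forest Rayleigh on the vertex type `V`** (Semple–Welsh's strong independence correlation, graphic case, in
fibre form): for every fibre `(M, u₀)` and all pairs `e ≠ f`, `#(Fo ∩ J_e ∩ J_f, Fo) ≤ #(Fo ∩ J_e, Fo ∩ J_f)`.  FALSE on `K₄`
(`not_forestRayleighNoSqOn_fin_four`); true on series–parallel graphs (Semple–Welsh Thm 4.2). [cite: SempleWelsh2008, Thm. 4.2 (p. 11)]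
[cite: Linusson2011, Prop. 2.6] -/
def ForestRayleighNoSqOn (V : Type*) [Fintype V] : Prop :=
  ∀ (M u₀ : BondConfig V), Disjoint u₀ M → ∀ (e f : Sym2 V), e ≠ f →
    fibreCount M u₀ (forestEv V ∩ {ω | e ∈ ω ∧ f ∈ ω}) (forestEv V) ≤
      fibreCount M u₀ (forestEv V ∩ {ω | e ∈ ω}) (forestEv V ∩ {ω | f ∈ ω})

/-- **All pairs ⇒ adjacent pairs.** [cite: SempleWelsh2008, Thm. 4.2 (p. 11)] -/
theorem adjForestRayleighNoSqOn_of_forestRayleighNoSqOn {V : Type*} [Fintype V] (h : ForestRayleighNoSqOn V) :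
    AdjForestRayleighNoSqOn V :=
  fun M u₀ hd o v y hvy => h M u₀ hd s(o, v) s(o, y) fun h' => hvy (Sym2.congr_right.1 h')

/-! ### `K₄` with the disjoint pair `e = 01`, `f = 23` -/

/-- **`K₄`** as listed data: pairs `0 = 01 (= e)`, `1 = 23 (= f)`, `2 = 02`, `3 = 03`, `4 = 12`, `5 = 13`; parameters unused. [cite: SempleWelsh2008, Thm. 4.2 (p. 11)] -/
abbrev k4D : RCEval where
  n := 4
  m := 6
  src := ![0, 2, 0, 0, 1, 1]
  dst := ![1, 3, 2, 3, 2, 3]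
  c := fun _ => 0
  q := 1

namespace ForestRayleighK4

open RCEval

/-- The data is valid. [folklore] -/
theorem valid : k4D.Valid := by decide +kernel

/-- No listed loop. [folklore] -/
theorem noloop : ∀ i, k4D.src i ≠ k4D.dst i := by decide +kernel

/-- Pair `0` is `e = 01`. [folklore] -/
theorem edge_zero : k4D.edge 0 = s((0 : Fin 4), 1) := by decide +kernel

/-- Pair `1` is `f = 23`. [folklore] -/
theorem edge_one : k4D.edge 1 = s((2 : Fin 4), 3) := by decide +kernel

/-- The complementary mask within the six pairs. [folklore] -/
def cpl (a : ℕ) : ℕ := Nat.xor 63 a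

/-- Indicator of `bad`: `e, f ∈ ω`, `ω` and `E ∖ ω` forests. [cite: SempleWelsh2008, Thm. 4.2 (p. 11)] -/
def gbad (a : ℕ) : Bool := a.testBit 0 && (a.testBit 1 && (k4D.forestB a && k4D.forestB (cpl a)))

/-- Indicator of `good`: `e ∈ ω` forest, `f ∈ E ∖ ω` forest. [cite: SempleWelsh2008, Thm. 4.2 (p. 11)] -/
def ggood (a : ℕ) : Bool := a.testBit 0 && (k4D.forestB a && ((cpl a).testBit 1 && k4D.forestB (cpl a)))

/-- **The count**: `bad + 0 + (64 − good) = 66`. (this file's `decide +kernel` evaluation) -/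
theorem sumR_eq_66 : sumR (fun a => cond (gbad a) 1 0 + cond false 1 0 + cond (ggood a) 0 1) 6 0 = 66 := by decide +kernel

/-- Membership of `e`, `f` in the configuration of a mask. [folklore] -/
theorem mem_iff (a : ℕ) :
    (s((0 : Fin 4), 1) ∈ k4D.conf (k4D.tOf a) ↔ a.testBit 0 = true) ∧ (s((2 : Fin 4), 3) ∈ k4D.conf (k4D.tOf a) ↔ a.testBit 1 = true) := by
  rw [← edge_zero, ← edge_one, edge_mem_conf valid, edge_mem_conf valid, mem_tOf, mem_tOf]
  exact ⟨Iff.rfl, Iff.rfl⟩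

/-- The complementary mask is the `xor` with `2⁶ − 1`. [folklore] -/
theorem cpl_eq (a : ℕ) : Nat.xor (2 ^ 6 - 1) a = cpl a := by norm_num [cpl]

/-- The `bad` predicate is `gbad`. [cite: SempleWelsh2008, Thm. 4.2 (p. 11)] -/
theorem bad_iff (a : ℕ) (_ha : a < 2 ^ 6) :
    (k4D.conf (k4D.tOf a) ∈ forestEv (Fin 4) ∩ {ω | s((0 : Fin 4), 1) ∈ ω ∧ s((2 : Fin 4), 3) ∈ ω} ∧
        k4D.conf (k4D.tOf (Nat.xor (2 ^ 6 - 1) a)) ∈ forestEv (Fin 4)) ↔ gbad a = true := by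
  rw [cpl_eq]
  simp only [Set.mem_inter_iff, Set.mem_setOf_eq, forestEv, (mem_iff a).1, (mem_iff a).2, gbad, Bool.and_eq_true,
    forestB_iff (D := k4D) _ valid noloop]
  tauto

/-- The `good` predicate is `ggood`. [cite: SempleWelsh2008, Thm. 4.2 (p. 11)] -/
theorem good_iff (a : ℕ) (_ha : a < 2 ^ 6) :
    (k4D.conf (k4D.tOf a) ∈ forestEv (Fin 4) ∩ {ω | s((0 : Fin 4), 1) ∈ ω} ∧
        k4D.conf (k4D.tOf (Nat.xor (2 ^ 6 - 1) a)) ∈ forestEv (Fin 4) ∩ {ω | s((2 : Fin 4), 3) ∈ ω}) ↔ ggood a = true := by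
  rw [cpl_eq]
  simp only [Set.mem_inter_iff, Set.mem_setOf_eq, forestEv, (mem_iff a).1, (mem_iff (cpl a)).2, ggood, Bool.and_eq_true,
    forestB_iff (D := k4D) _ valid noloop]
  tauto

/-- The (empty) middle predicate. [folklore] -/
theorem false_iff (a : ℕ) (_ha : a < 2 ^ 6) :
    (k4D.conf (k4D.tOf a) ∈ (∅ : Set (BondConfig (Fin 4))) ∧ k4D.conf (k4D.tOf (Nat.xor (2 ^ 6 - 1) a)) ∈ (∅ : Set (BondConfig (Fin 4)))) ↔
      (fun _ : ℕ => false) a = true := by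
  simp

/-- **`¬ ForestRayleighNoSqOn (Fin 4)`**: on `K₄` with the disjoint pair `e = 01`, `f = 23` (fibre = all six edges, `u₀ = ∅`),
`bad = 4 > 2 = good` — `M(K₄)` is not strongly independence correlated (Semple–Welsh 2008, Thm 4.2); the adjacency hypothesis of
`AdjForestRayleighNoSqOn` cannot be dropped. [cite: SempleWelsh2008, Thm. 4.2 (p. 11)] -/
theorem not_forestRayleighNoSqOn_fin_four : ¬ ForestRayleighNoSqOn (Fin 4) := by
  intro h
  have h6 : (6 : ℕ) ≤ k4D.m := by decide
  have h01 : s((0 : Fin 4), 1) ≠ s((2 : Fin 4), 3) := by decide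
  have key := h (k4D.conf (k4D.firstT 6)) ∅ disjoint_bot_left _ _ h01
  have hzero : fibreCount (k4D.conf (k4D.firstT 6)) ∅ (∅ : Set (BondConfig (Fin 4))) ∅ = 0 :=
    fibreCount_eq_zero_of_left _ _ rfl _
  rw [fibreCount_conf_eq_card_bool valid h6 gbad bad_iff, fibreCount_conf_eq_card_bool valid h6 ggood good_iff] at key
  rw [fibreCount_conf_eq_card_bool valid h6 (fun _ => false) false_iff] at hzero
  obtain ⟨h3, hle⟩ := three_counts_eq_sumR 6 gbad (fun _ => false) ggood
  rw [sumR_eq_66, hzero] at h3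
  generalize ((Finset.range (2 ^ 6)).filter fun a => gbad a = true).card = c₁ at h3 key
  generalize ((Finset.range (2 ^ 6)).filter fun a => ggood a = true).card = c₃ at h3 hle key
  have h64 : (2 : ℕ) ^ 6 = 64 := by norm_num
  rw [h64] at h3 hle
  omega

end ForestRayleighK4

end FK

end Summit.CriticalPhenomena.PercolationContinuityZ3.Theorems
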